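import Summits.AtomisticToContinuum.HydrodynamicLimit.Theorems.StiffCollisionalRelaxationAprioriBoundsFibreDefsR4
import Summits.AtomisticToContinuum.HydrodynamicLimit.Theses.GermanoSplitLES
import Summits.AtomisticToContinuum.HydrodynamicLimit.Theorems.StiffCollisionalRelaxationAprioriBoundsEntropyRange
import Summits.AtomisticToContinuum.HydrodynamicLimit.Theorems.CollisionIsometryCLTAdaptedWeightCLTTLPastDampingDensityCap
import Summits.AtomisticToContinuum.HydrodynamicLimit.Theorems.AprioriBounds.Negative.ExpMomentTangent
import Literature.MathematicalPhysics.KineticTheory.HardSphereEulerSolutionGluing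
import Literature.MathematicalPhysics.KineticTheory.HardSphereEulerProofs
import Literature.MathematicalPhysics.KineticTheory.HardSphereTwoTimePressure
import Literature.Analysis.FluidPDE.ReleaseLogBoundDatum
import Literature.Analysis.FluidPDE.HardSpherePhaseSpaceProofs
import HarnessLib

/-!
# The ceiling in the mean from `GermanoSplitLES.KineticRangeControl` (dock of stub `stub_meanCeiling`,
# line `meso-chebyshev-window`, crux `AprioriBounds`, stmt-AtomisticToContinuum-14827)

Helper file (`--supports stmt-AtomisticToContinuum-14827`) of the line `meso-chebyshev-window` for the crux
`Summit.AtomisticToContinuum.HydrodynamicLimit.Theses.StiffCollisionalRelaxation.AprioriBounds`.  The registered stub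
`stub_meanCeiling` asks, under the crux prefix (profiles → `∃ σ₀ ∃ η₁ ∀ σ < σ₀` → classical hs-Euler solution on
`[0, T)` → flow family with the `t = 0` LLN → `0 < t < T` with the chamber `2ρσ³ < η₁` on `[0, t]`), for every
admissible kernel family at mesoscale `(N+1)^{-γ}`, `γ ≤ 1/15`, a CEILING IN THE MEAN relative to packing:
`∃ κ < 1 ∃ N₀ ∀ N ≥ N₀ ∀ s ∈ [0,t] ∀ x, E_{P_N} ρ̄_φ(s,x) · σ³ ≤ κ`,
`ρ̄_φ(s,x) = empiricalDensityField ((Φ N).flow s z) (fun y => φ N (y - x))`.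

This file DOCKS the stub into the crux `KineticRangeControl` of route `GermanoSplitLES`
(stmt-AtomisticToContinuum-9201), exactly as the landed `AdiabatCeiling.partTwo_of_kineticRangeControl` docks
component (ii): that item provides, for EVERY target band `η₀ > 0`, a box ceiling `ρ̄ ≤ C_ρ` with `C_ρ σ³ < η₀`
holding for all `s ≤ t`, `x ∈ 𝕋³` off an event of vanishing probability.  The ceiling in the MEAN follows from
the box ceiling IN PROBABILITY because the block density is DETERMINISTICALLY capped on good orbits by the hard
core: `ρ̄ ≤ 27 C / σ³` (`PastDamping.sum_kernel_le`, at most `(2h/ε + 1)³ ≤ 27 (N+1)^{1-3γ}/σ³` centres of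
`ε`-separated spheres in a kernel ball), so

  `E ρ̄ σ³ ≤ C_ρ σ³ + 27 C · P_N(bad) ≤ η₀ + 27 C · P_N(bad)`   (`meanCeiling_integral_le_of_ae_cap`),

and with `η₀ := 1/2`, `η₁ := 1/2`, `σ₀ := min σ₀(item) (1/2)` and `N₀` beyond which `27 C · P_N(bad) ≤ 1/4` and
`(N+1)^{-γ} < 1/4` (room for the packing count), `κ := 3/4` serves (`meanCeiling_of_kineticRangeControl`).
Bookkeeping copied from the (ii)-dock: chamber extension to a life `[0, T')` (`AdiabatCeiling.exists_chamber_extension`,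
`IsHardSphereEulerSolution.restrict`), the REFLECTED kernel family `y ↦ φ_N(−y)` (the item mollifies with
`φ_N(x − y)`), its admissibility at `ℓ_N = (N+1)^{-γ}` with `A := 2C`, `ℓ_N → 0`, `(N+1)ℓ_N³/log(N+2) → ∞`.

So the stub is WEAKER than the import stmt-9201 that the `Sketch`-type lines consume for (ii); it is not a new
kind of input.  No new definitions, no named facts; axioms `propext`, `Classical.choice`, `Quot.sound`.
-/

noncomputable section

open MeasureTheory ProbabilityTheory Filter Set Topology
open scoped ENNReal

namespace Summit.AtomisticToContinuum.HydrodynamicLimit.Theorems.MesoChebyshevWindow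

open Literature.MathematicalPhysics.KineticTheory Literature.Analysis.FluidPDE
open Summit.AtomisticToContinuum.HydrodynamicLimit.Theorems.AprioriBoundsNegative (PartOneAt PartTwoAt)
open Summit.AtomisticToContinuum.HydrodynamicLimit.Theorems.VisitLedgerUpscattering (Cfg Flow Flows NiceProfiles)
open Summit.AtomisticToContinuum.HydrodynamicLimit.Theorems.FibreDeficitTransfer

/-! ## Elementary facts about the mesoscale `ℓ_N = (N+1)^{-γ}` (copied from the (ii)-dock) -/

-- adapted from Theorems/StiffCollisionalRelaxationAprioriBoundsPartTwoOfKineticRangeControl.lean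
/-- `x^{3γ} · (x^{-γ})³ = 1` for `x > 0`. -/
private theorem mcKRC_rpow_three_mul_mul_cube {x : ℝ} (hx : 0 < x) (γ : ℝ) :
    x ^ (3 * γ) * (x ^ (-γ)) ^ 3 = 1 := by
  have h3 : (x ^ (-γ)) ^ 3 = x ^ (-γ * 3) := by rw [Real.rpow_mul hx.le, Real.rpow_ofNat]
  rw [h3, ← Real.rpow_add hx, show 3 * γ + -γ * 3 = 0 by ring, Real.rpow_zero]

-- adapted from Theorems/StiffCollisionalRelaxationAprioriBoundsPartTwoOfKineticRangeControl.lean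
/-- `x^{4γ} · (x^{-γ})⁴ = 1` for `x > 0`. -/
private theorem mcKRC_rpow_four_mul_mul_fourth {x : ℝ} (hx : 0 < x) (γ : ℝ) :
    x ^ (4 * γ) * (x ^ (-γ)) ^ 4 = 1 := by
  have h4 : (x ^ (-γ)) ^ 4 = x ^ (-γ * 4) := by rw [Real.rpow_mul hx.le, Real.rpow_ofNat]
  rw [h4, ← Real.rpow_add hx, show 4 * γ + -γ * 4 = 0 by ring, Real.rpow_zero]

-- adapted from Theorems/StiffCollisionalRelaxationAprioriBoundsPartTwoOfKineticRangeControl.lean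
/-- `ℓ_N = (N+1)^{-γ} → 0` for `γ > 0`. -/
private theorem mcKRC_tendsto_scale {γ : ℝ} (hγ : 0 < γ) :
    Tendsto (fun N : ℕ => ((N : ℝ) + 1) ^ (-γ)) atTop (𝓝 0) :=
  (tendsto_rpow_neg_atTop hγ).comp (tendsto_natCast_atTop_atTop.atTop_add tendsto_const_nhds)

-- adapted from Theorems/StiffCollisionalRelaxationAprioriBoundsPartTwoOfKineticRangeControl.lean
/-- The admissibility rate of the item: `(N+1) ℓ_N³ / log(N+2) = (N+1)^{1-3γ} / log(N+2) → ∞` for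
`0 < γ ≤ 1/15`. -/
private theorem mcKRC_tendsto_rate {γ : ℝ} (hγ : 0 < γ) (hγ' : γ ≤ 1 / 15) :
    Tendsto (fun N : ℕ => ((N : ℝ) + 1) * (((N : ℝ) + 1) ^ (-γ)) ^ 3 / Real.log ((N : ℝ) + 2))
      atTop atTop := by
  set a : ℝ := 1 - 3 * γ with ha
  have ha0 : 0 < a := by rw [ha]; linarith
  set ε : ℝ := a / 2 with hε
  have hε0 : 0 < ε := by positivity
  have hae : 0 < a - ε := by rw [hε]; linarith
  have hlow : ∀ N : ℕ, ε / 2 * ((N : ℝ) + 1) ^ (a - ε) ≤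
      ((N : ℝ) + 1) * (((N : ℝ) + 1) ^ (-γ)) ^ 3 / Real.log ((N : ℝ) + 2) := by
    intro N
    have hx : 0 < (N : ℝ) + 1 := by positivity
    have hx2 : 0 < (N : ℝ) + 2 := by positivity
    have hnum : ((N : ℝ) + 1) * (((N : ℝ) + 1) ^ (-γ)) ^ 3 = ((N : ℝ) + 1) ^ a := by
      have h3 : (((N : ℝ) + 1) ^ (-γ)) ^ 3 = ((N : ℝ) + 1) ^ (-γ * 3) := by
        rw [Real.rpow_mul hx.le, Real.rpow_ofNat]
      rw [h3, show a = 1 + -γ * 3 by rw [ha]; ring, Real.rpow_add hx, Real.rpow_one]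
    have hlog_pos : 0 < Real.log ((N : ℝ) + 2) := Real.log_pos (by linarith)
    have hlog : Real.log ((N : ℝ) + 2) ≤ 2 * ((N : ℝ) + 1) ^ ε / ε := by
      have h1 : Real.log ((N : ℝ) + 2) ≤ ((N : ℝ) + 2) ^ ε / ε := Real.log_le_rpow_div hx2.le hε0
      have h2 : ((N : ℝ) + 2) ^ ε ≤ 2 * ((N : ℝ) + 1) ^ ε := by
        calc ((N : ℝ) + 2) ^ ε ≤ (2 * ((N : ℝ) + 1)) ^ ε :=
              Real.rpow_le_rpow hx2.le (by linarith) hε0.le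
          _ = 2 ^ ε * ((N : ℝ) + 1) ^ ε := Real.mul_rpow (by norm_num) hx.le
          _ ≤ (2 : ℝ) ^ (1 : ℝ) * ((N : ℝ) + 1) ^ ε := by
              gcongr
              · norm_num
              · rw [hε, ha]; linarith
          _ = 2 * ((N : ℝ) + 1) ^ ε := by rw [Real.rpow_one]
      exact h1.trans (by gcongr)
    rw [hnum, le_div_iff₀ hlog_pos]
    calc ε / 2 * ((N : ℝ) + 1) ^ (a - ε) * Real.log ((N : ℝ) + 2)
        ≤ ε / 2 * ((N : ℝ) + 1) ^ (a - ε) * (2 * ((N : ℝ) + 1) ^ ε / ε) := by gcongr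
      _ = ((N : ℝ) + 1) ^ (a - ε) * ((N : ℝ) + 1) ^ ε := by field_simp
      _ = ((N : ℝ) + 1) ^ a := by rw [← Real.rpow_add hx, sub_add_cancel]
  refine tendsto_atTop_mono hlow ?_
  exact Tendsto.const_mul_atTop (by positivity)
    ((tendsto_rpow_atTop hae).comp (tendsto_natCast_atTop_atTop.atTop_add tendsto_const_nhds))

/-! ## The reflected kernel family `y ↦ φ_N(−y)` is admissible for the item (copied from the (ii)-dock) -/

-- adapted from Theorems/StiffCollisionalRelaxationAprioriBoundsPartTwoOfKineticRangeControl.lean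
/-- `dist(−x, 0) = dist(x, 0)` for the minimal-image distance on `𝕋³`. -/
private theorem mcKRC_euclidDist_neg_zero (x : T3) :
    Torus.euclidDist (-x) 0 = Torus.euclidDist x 0 := by
  rw [Torus.euclidDist_comm x 0, Torus.euclidDist_eq, Torus.euclidDist_eq, sub_zero, zero_sub]

-- adapted from Theorems/StiffCollisionalRelaxationAprioriBoundsPartTwoOfKineticRangeControl.lean
/-- The item's kernel hypotheses for the reflected family `y ↦ φ_N(−y)` of an admissible kernel family at
`ℓ_N := (N+1)^{-γ}`: continuity, sign, unit mass, support, and the height/Lipschitz constant `A := 2C`. -/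
private theorem mcKRC_reflected_admissible {γ C : ℝ} {φ : ℕ → T3 → ℝ}
    (hφ : (∀ N, Literature.Analysis.FunctionSpaces.Torus.IsSmooth (φ N)) ∧ (∀ N y, 0 ≤ φ N y) ∧
      (∀ N, ∫ y, φ N y = 1) ∧
      (∀ (N : ℕ) y, ((N : ℝ) + 1) ^ (-γ) ≤ Torus.euclidDist y 0 → φ N y = 0) ∧
      (∀ (N : ℕ) y, φ N y ≤ C * ((N : ℝ) + 1) ^ (3 * γ)) ∧
      (∀ (N : ℕ) y, ‖Literature.Analysis.FunctionSpaces.Torus.gradient (φ N) y‖ ≤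
        C * ((N : ℝ) + 1) ^ (4 * γ))) :
    (∀ N : ℕ, Continuous (fun y : T3 => φ N (-y))) ∧ (∀ (N : ℕ) (x : T3), 0 ≤ φ N (-x)) ∧
    (∀ N : ℕ, ∫ x : T3, φ N (-x) = 1) ∧
    (∀ (N : ℕ) (x : T3), ((N : ℝ) + 1) ^ (-γ) < Torus.euclidDist x 0 → φ N (-x) = 0) ∧
    (∃ A : ℝ, ∀ (N : ℕ) (x y : T3), φ N (-x) * (((N : ℝ) + 1) ^ (-γ)) ^ 3 ≤ A ∧
      |φ N (-x) - φ N (-y)| * (((N : ℝ) + 1) ^ (-γ)) ^ 4 ≤ A * Torus.euclidDist x y) := by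
  obtain ⟨hsm, hnn, hmass, hsupp, hsup, hgrad⟩ := hφ
  haveI : (volume : Measure T3).IsNegInvariant := Pi.isNegInvariant_volume
  refine ⟨fun N => (hsm N).continuous.comp continuous_neg, fun N x => hnn N (-x),
    fun N => (integral_neg_eq_self (φ N) volume).trans (hmass N),
    fun N x hx => hsupp N (-x) (by rw [mcKRC_euclidDist_neg_zero]; exact hx.le),
    ⟨2 * C, fun N x y => ?_⟩⟩
  have hx : 0 < (N : ℝ) + 1 := by positivity
  have hC : 0 ≤ C := by
    have h := (hnn N x).trans (hsup N x)
    exact nonneg_of_mul_nonneg_left h (Real.rpow_pos_of_pos hx _)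
  constructor
  · calc φ N (-x) * (((N : ℝ) + 1) ^ (-γ)) ^ 3
        ≤ C * ((N : ℝ) + 1) ^ (3 * γ) * (((N : ℝ) + 1) ^ (-γ)) ^ 3 := by
          gcongr
          exact hsup N (-x)
      _ = C := by rw [mul_assoc, mcKRC_rpow_three_mul_mul_cube hx, mul_one]
      _ ≤ 2 * C := by linarith
  · have hmv := Literature.Analysis.FluidPDE.Torus.abs_sub_le_of_norm_gradient_le (hsm N)
      (fun z => hgrad N z) (-x) (-y)
    have hsqrt : Real.sqrt (Fintype.card (Fin 3) : ℕ) ≤ 2 := by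
      rw [Fintype.card_fin, Real.sqrt_le_left (by norm_num)]
      norm_num
    have hL : 0 ≤ C * ((N : ℝ) + 1) ^ (4 * γ) := mul_nonneg hC (Real.rpow_pos_of_pos hx _).le
    have hdist : ‖-x - -y‖ ≤ Torus.euclidDist x y := by
      rw [neg_sub_neg, norm_sub_rev]
      exact Literature.Analysis.FluidPDE.Torus.norm_sub_le_euclidDist_holds x y
    have hd0 : 0 ≤ Torus.euclidDist x y := by rw [Torus.euclidDist_eq]; exact norm_nonneg _
    calc |φ N (-x) - φ N (-y)| * (((N : ℝ) + 1) ^ (-γ)) ^ 4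
        ≤ Real.sqrt (Fintype.card (Fin 3) : ℕ) * (C * ((N : ℝ) + 1) ^ (4 * γ)) * ‖-x - -y‖ *
            (((N : ℝ) + 1) ^ (-γ)) ^ 4 := by gcongr
      _ ≤ 2 * (C * ((N : ℝ) + 1) ^ (4 * γ)) * Torus.euclidDist x y *
            (((N : ℝ) + 1) ^ (-γ)) ^ 4 := by gcongr
      _ = 2 * C * Torus.euclidDist x y *
            (((N : ℝ) + 1) ^ (4 * γ) * (((N : ℝ) + 1) ^ (-γ)) ^ 4) := by ring
      _ = 2 * C * Torus.euclidDist x y := by rw [mcKRC_rpow_four_mul_mul_fourth hx, mul_one]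

/-! ## The hard-core cap of the block density and the in-mean bound off a rare event -/

/-- **The packing constant.**  For `0 < σ ≤ 1`, `γ ≤ 1/3`, `0 ≤ C`:
`(N+1)⁻¹ · C (N+1)^{3γ} · (2 (N+1)^{-γ}/ε_N + 1)³ ≤ 27 C / σ³`, `ε_N = hsDiameter σ N = σ (N+1)^{-1/3}`
(since `ε_N ≤ (N+1)^{-γ}`, the bracket is at most `3 (N+1)^{-γ}/ε_N`, whose cube is `27 (N+1)^{1-3γ}/σ³`). -/
theorem meanCeiling_packing_const {σ γ C : ℝ} (hσ : 0 < σ) (hσ1 : σ ≤ 1) (hγ : γ ≤ 1 / 3)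
    (hC : 0 ≤ C) (N : ℕ) :
    ((N + 1 : ℕ) : ℝ)⁻¹ * (C * ((N : ℝ) + 1) ^ (3 * γ) *
        (2 * ((N : ℝ) + 1) ^ (-γ) / hsDiameter σ N + 1) ^ 3) ≤ 27 * C / σ ^ 3 := by
  have hx : 0 < (N : ℝ) + 1 := by positivity
  have hx1 : 1 ≤ (N : ℝ) + 1 := by linarith [(Nat.cast_nonneg N : (0 : ℝ) ≤ N)]
  have hcast : ((N + 1 : ℕ) : ℝ) = (N : ℝ) + 1 := by push_cast; ring
  have hε : hsDiameter σ N = σ * ((N : ℝ) + 1) ^ (-(1 / 3 : ℝ)) := by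
    rw [hsDiameter, hcast]
  have hεpos : 0 < hsDiameter σ N := hsDiameter_pos hσ N
  set R : ℝ := ((N : ℝ) + 1) ^ (-γ) with hR
  have hRpos : 0 < R := Real.rpow_pos_of_pos hx _
  -- `ε_N ≤ R`
  have hεR : hsDiameter σ N ≤ R := by
    rw [hε, hR]
    calc σ * ((N : ℝ) + 1) ^ (-(1 / 3 : ℝ)) ≤ 1 * ((N : ℝ) + 1) ^ (-γ) := by
          gcongr
      _ = ((N : ℝ) + 1) ^ (-γ) := one_mul _
  -- the bracket is at most `3 R / ε`
  have hbr : 2 * R / hsDiameter σ N + 1 ≤ 3 * R / hsDiameter σ N := by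
    have h1 : 1 ≤ R / hsDiameter σ N := by rwa [le_div_iff₀ hεpos, one_mul]
    calc 2 * R / hsDiameter σ N + 1 ≤ 2 * R / hsDiameter σ N + R / hsDiameter σ N := by linarith
      _ = 3 * R / hsDiameter σ N := by ring
  have hbr0 : 0 ≤ 2 * R / hsDiameter σ N + 1 := by positivity
  -- cubes: `R³ · (N+1)^{3γ} = 1`, `ε³ = σ³ / (N+1)`
  have hR3 : ((N : ℝ) + 1) ^ (3 * γ) * R ^ 3 = 1 := mcKRC_rpow_three_mul_mul_cube hx γ
  have hε3 : hsDiameter σ N ^ 3 = σ ^ 3 / ((N : ℝ) + 1) := by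
    rw [hε, mul_pow, ← Real.rpow_natCast (((N : ℝ) + 1) ^ (-(1 / 3 : ℝ))) 3, ← Real.rpow_mul hx.le]
    norm_num
    rw [Real.rpow_neg_one, div_eq_mul_inv]
  calc ((N + 1 : ℕ) : ℝ)⁻¹ * (C * ((N : ℝ) + 1) ^ (3 * γ) * (2 * R / hsDiameter σ N + 1) ^ 3)
      ≤ ((N + 1 : ℕ) : ℝ)⁻¹ * (C * ((N : ℝ) + 1) ^ (3 * γ) * (3 * R / hsDiameter σ N) ^ 3) := by
        rw [hcast]
        gcongr
    _ = 27 * C * (((N : ℝ) + 1) ^ (3 * γ) * R ^ 3) * (((N : ℝ) + 1)⁻¹ / hsDiameter σ N ^ 3) := by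
        rw [hcast, div_pow]
        ring
    _ = 27 * C / σ ^ 3 := by
        rw [hR3, mul_one, hε3]
        field_simp

/-- **The block density is measurable** (along a fixed time-`s` map of a hard-sphere flow, continuous kernel). -/
theorem meanCeiling_measurable_blockDensity_flow {σ : ℝ} {N : ℕ}
    (Φ : HardSphereFlow (Torus.geometry (Fin 3)) (hsDiameter σ N) (N + 1)) (s : ℝ) {φ : T3 → ℝ}
    (hφ : Continuous φ) (x : T3) :
    Measurable fun z : Config (N + 1) (Fin 3) T3 =>
      empiricalDensityField (Φ.flow s z) (fun y => φ (y - x)) := by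
  have h : (fun z : Config (N + 1) (Fin 3) T3 => empiricalDensityField (Φ.flow s z) (fun y => φ (y - x))) =
      fun z => ((N + 1 : ℕ) : ℝ)⁻¹ * ∑ i, φ ((Φ.flow s z i).1 - x) :=
    funext fun z => AprioriBoundsNegative.empiricalDensityField_eq_sum _ _
  rw [h]
  have hm : ∀ i : Fin (N + 1), Measurable fun z : Config (N + 1) (Fin 3) T3 => (Φ.flow s z i).1 :=
    fun i => ((measurable_pi_apply i).comp (Φ.measurable_flow s)).fst
  refine measurable_const.mul (Finset.measurable_sum _ fun i _ => ?_)
  exact (hφ.comp (continuous_sub_right x)).measurable.comp (hm i)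

/-- **Hard-core cap of the block density, almost surely.**  For `0 < σ ≤ 1/2`, a kernel `0 ≤ φ ≤ C(N+1)^{3γ}`
supported in the minimal-image ball of radius `(N+1)^{-γ}` (`γ ≤ 1/3`) and `(N+1)^{-γ} < 1/4`: for
`P_N`-a.e. `z` (namely on the good set, whose orbits stay in the hard-sphere domain),
`ρ̄_φ(Φ_s z, x) ≤ 27 C / σ³` (`PastDamping.sum_kernel_le` + `meanCeiling_packing_const`). -/
theorem meanCeiling_blockDensity_le_cap_ae {σ : ℝ} (hσ : 0 < σ) (hσ2 : σ ≤ 1 / 2) (a₀ θ₀ : T3 → ℝ)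
    (u₀ : T3 → V3) {N : ℕ} (Φ : HardSphereFlow (Torus.geometry (Fin 3)) (hsDiameter σ N) (N + 1)) (s : ℝ)
    (x : T3) {γ C : ℝ} (hγ : γ ≤ 1 / 3) {φ : T3 → ℝ} (hφ0 : ∀ y, 0 ≤ φ y)
    (hφC : ∀ y, φ y ≤ C * ((N : ℝ) + 1) ^ (3 * γ))
    (hsupp : ∀ y, ((N : ℝ) + 1) ^ (-γ) ≤ Torus.euclidDist y 0 → φ y = 0)
    (hsmall : ((N : ℝ) + 1) ^ (-γ) < 1 / 4) :
    ∀ᵐ z ∂(localGibbsLaw σ a₀ u₀ θ₀ N Φ),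
      empiricalDensityField (Φ.flow s z) (fun y => φ (y - x)) ≤ 27 * C / σ ^ 3 := by
  have hx : 0 < (N : ℝ) + 1 := by positivity
  have hC : 0 ≤ C := by
    have h := (hφ0 0).trans (hφC 0)
    exact nonneg_of_mul_nonneg_left h (Real.rpow_pos_of_pos hx _)
  have hε : 0 < hsDiameter σ N := hsDiameter_pos hσ N
  have hR : 0 ≤ ((N : ℝ) + 1) ^ (-γ) := Real.rpow_nonneg hx.le _
  have hhalf : ((N : ℝ) + 1) ^ (-γ) + hsDiameter σ N / 2 < 1 / 2 := by
    have h := hsDiameter_le hσ.le N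
    linarith
  filter_upwards [ae_mem_good_localGibbsLaw σ a₀ u₀ θ₀ N Φ] with z hz
  have hdom : Φ.flow s z ∈ hardSphereDomain (Torus.geometry (Fin 3)) (N + 1) (hsDiameter σ N) :=
    Φ.good_subset (Φ.mapsTo_good s hz)
  have hsum := ContactSourceDuhamel.TimeLocal.PastDamping.sum_kernel_le hdom φ hφ0 hφC hsupp hε hR hhalf x
  rw [AprioriBoundsNegative.empiricalDensityField_eq_sum]
  calc ((N + 1 : ℕ) : ℝ)⁻¹ * ∑ i, φ ((Φ.flow s z i).1 - x)
      ≤ ((N + 1 : ℕ) : ℝ)⁻¹ * (C * ((N : ℝ) + 1) ^ (3 * γ) *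
          (2 * ((N : ℝ) + 1) ^ (-γ) / hsDiameter σ N + 1) ^ 3) :=
        mul_le_mul_of_nonneg_left hsum (by positivity)
    _ ≤ 27 * C / σ ^ 3 := meanCeiling_packing_const hσ (by linarith) hγ hC N

/-- **Mean of a capped observable off a rare event.**  On a probability space, if `0 ≤ f ≤ K` a.e. and `f ≤ c`
a.e. off a (not necessarily measurable) set `B` with `P B ≤ δ`, `0 ≤ c`, `0 ≤ K`, `0 ≤ δ`, then
`∫ f dP ≤ c + K δ` (compare with `c + K 𝟙_{B'}` for a measurable hull `B'` of `B`). -/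
theorem meanCeiling_integral_le_of_ae_cap {Ω : Type*} [MeasurableSpace Ω] (P : Measure Ω)
    [IsProbabilityMeasure P] {f : Ω → ℝ} (hf : AEStronglyMeasurable f P) {c K δ : ℝ} (hc : 0 ≤ c)
    (hK : 0 ≤ K) (hδ : 0 ≤ δ) {B : Set Ω} (h0 : ∀ᵐ z ∂P, 0 ≤ f z) (hcap : ∀ᵐ z ∂P, f z ≤ K)
    (hbox : ∀ᵐ z ∂P, z ∉ B → f z ≤ c) (hPB : P B ≤ ENNReal.ofReal δ) :
    ∫ z, f z ∂P ≤ c + K * δ := by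
  set B' := toMeasurable P B with hB'
  have hB'm : MeasurableSet B' := measurableSet_toMeasurable P B
  have hBB' : B ⊆ B' := subset_toMeasurable P B
  have hPB' : P.real B' ≤ δ := by
    rw [measureReal_def, hB', measure_toMeasurable]
    exact ENNReal.toReal_le_of_le_ofReal hδ hPB
  set g : Ω → ℝ := fun z => c + B'.indicator (fun _ => K) z with hg
  have hgi : Integrable g P := (integrable_const c).add ((integrable_const K).indicator hB'm)
  have hfi : Integrable f P := by
    refine Integrable.of_bound hf K ?_
    filter_upwards [h0, hcap] with z h0z hKz
    rw [Real.norm_eq_abs, abs_of_nonneg h0z]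
    exact hKz
  have hfg : f ≤ᵐ[P] g := by
    filter_upwards [hcap, hbox] with z hKz hbz
    by_cases hzB : z ∈ B'
    · rw [hg]
      simp only [Set.indicator_of_mem hzB]
      linarith
    · rw [hg]
      simp only [Set.indicator_of_notMem hzB, add_zero]
      exact hbz fun h => hzB (hBB' h)
  calc ∫ z, f z ∂P ≤ ∫ z, g z ∂P := integral_mono_ae hfi hgi hfg
    _ = c + P.real B' * K := by
        rw [hg, integral_add (integrable_const c) ((integrable_const K).indicator hB'm), integral_const,
          integral_indicator_const K hB'm, probReal_univ, one_smul, smul_eq_mul]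
    _ ≤ c + δ * K := by gcongr
    _ = c + K * δ := by ring

/-! ## The ceiling in the mean from stmt-9201 -/

/-- **Stub `stub_meanCeiling` from `GermanoSplitLES.KineticRangeControl` (stmt-9201).**  The item at band
`η₀ := 1/2` supplies `σ₀`; take `σ₀' := min σ₀ (1/2)` and `η₁ := 1/2`.  Given the data: the chamber `2ρσ³ < 1/2`
on `[0, t]` gives `ρσ³ < 1/2` there, extended to a life `[0, T')`, `t < T' ≤ T` (`exists_chamber_extension`);
restrict the solution; feed the item the reflected kernel family at `ℓ_N = (N+1)^{-γ}`; it returns `c, C_ρ, C'`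
with `C_ρ σ³ < 1/2` and `P_N(bad) → 0` for the event that some `(s, x) ∈ [0,t] × 𝕋³` leaves the box.  For `N`
with `(N+1)^{-γ} < 1/4` and `P_N(bad) < 1/(4(27C+1))`, and every `s ∈ [0,t]`, `x`: a.e. `ρ̄ ≤ 27C/σ³`
(`meanCeiling_blockDensity_le_cap_ae`), `ρ̄ ≤ C_ρ` off the bad event (`φ_N(−(x − y)) = φ_N(y − x)`), hence
`E ρ̄ ≤ C_ρ + (27C/σ³) P_N(bad)` (`meanCeiling_integral_le_of_ae_cap`) and `E ρ̄ σ³ ≤ 1/2 + 1/4 = 3/4 =: κ`. -/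
theorem meanCeiling_of_kineticRangeControl : Summit.AtomisticToContinuum.HydrodynamicLimit.Theses.GermanoSplitLES.KineticRangeControl → ∀ (a₀ θ₀ : T3 → ℝ) (u₀ : T3 → V3), Continuous a₀ → Continuous θ₀ → Continuous u₀ → (∀ x, 0 < a₀ x) → (∀ x, 0 < θ₀ x) → ∃ σ₀ : ℝ, 0 < σ₀ ∧ ∃ η₁ : ℝ, 0 < η₁ ∧ ∀ σ : ℝ, 0 < σ → σ < σ₀ → ∀ (T : ℝ) (ρ θ : ℝ → T3 → ℝ) (u : ℝ → T3 → V3), IsHardSphereEulerSolution σ T ρ u θ → ∀ Φ : (N : ℕ) → HardSphereFlow (Torus.geometry (Fin 3)) (hsDiameter σ N) (N + 1), TendstoHydroFieldsAt (fun N => localGibbsLaw σ a₀ u₀ θ₀ N (Φ N)) Φ ρ u θ 0 → ∀ t : ℝ, 0 < t → t < T → (∀ s ∈ Icc 0 t, ∀ x, 2 * ρ s x * σ ^ 3 < η₁) → ∀ (γ C : ℝ) (φ : ℕ → T3 → ℝ), 0 < γ → γ ≤ 1 / 15 → ((∀ N, Literature.Analysis.FunctionSpaces.Torus.IsSmooth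 (φ N)) ∧ (∀ N y, 0 ≤ φ N y) ∧ (∀ N, ∫ y, φ N y = 1) ∧ (∀ (N : ℕ) y, ((N : ℝ) + 1) ^ (-γ) ≤ Torus.euclidDist y 0 → φ N y = 0) ∧ (∀ (N : ℕ) y, φ N y ≤ C * ((N : ℝ) + 1) ^ (3 * γ)) ∧ (∀ (N : ℕ) y, ‖Literature.Analysis.FunctionSpaces.Torus.gradient (φ N) y‖ ≤ C * ((N : ℝ) + 1) ^ (4 * γ))) → ∃ κ : ℝ, κ < 1 ∧ ∃ N₀ : ℕ, ∀ N : ℕ, N₀ ≤ N → ∀ s ∈ Icc 0 t, ∀ x : T3, (∫ z, empiricalDensityField ((Φ N).flow s z) (fun y => φ N (y - x)) ∂(localGibbsLaw σ a₀ u₀ θ₀ N (Φ N))) * σ ^ 3 ≤ κ := by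
  intro hK a₀ θ₀ u₀ ha hθ hu ha0 hθ0
  -- the item at level `η₀ := 1/2`
  obtain ⟨σ₀, hσ₀, H⟩ := hK (1 / 2) one_half_pos a₀ θ₀ u₀ ha hθ hu ha0 hθ0
  refine ⟨min σ₀ (1 / 2), lt_min hσ₀ one_half_pos, 1 / 2, one_half_pos,
    fun σ hσ hσlt T ρ θ u hE Φ hL t ht htT hch γ C φ hγ hγ' hφ => ?_⟩
  have hσ₀' : σ < σ₀ := lt_of_lt_of_le hσlt (min_le_left _ _)
  have hσ2 : σ ≤ 1 / 2 := (lt_of_lt_of_le hσlt (min_le_right _ _)).le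
  have hσ3 : 0 < σ ^ 3 := pow_pos hσ 3
  -- the chamber `2ρσ³ < 1/2` on `[0, t]` gives `ρσ³ < 1/2` there; extend it to a life `[0, T')` and restrict
  have hch1 : ∀ s ∈ Icc 0 t, ∀ x, ρ s x * σ ^ 3 < 1 / 2 := fun s hs x => by
    have h := hch s hs x
    linarith
  obtain ⟨T', htT', hT'T, hch'⟩ := AdiabatCeiling.exists_chamber_extension hE hσ ht.le htT hch1
  have hE' := hE.restrict hT'T
  -- the reflected kernel family at `ℓ_N = (N+1)^{-γ}`
  obtain ⟨h1, h2, h3, h4, h5⟩ := mcKRC_reflected_admissible hφ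
  have h6 : ∀ N : ℕ, 0 < ((N : ℝ) + 1) ^ (-γ) := fun N => Real.rpow_pos_of_pos (by positivity) _
  obtain ⟨c, Cρ, C', hc, hCρ, hin, hT⟩ := H σ hσ hσ₀' T' ρ θ u hE' hch' Φ hL (fun N y => φ N (-y))
    (fun N => ((N : ℝ) + 1) ^ (-γ)) h1 h2 h3 h4 h5 h6 (mcKRC_tendsto_scale hγ)
    (mcKRC_tendsto_rate hγ hγ') t ⟨ht.le, htT'⟩
  -- constants
  obtain ⟨hsm, hnn, -, hsupp, hsup, -⟩ := hφ
  have hC : 0 ≤ C := by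
    have h := (hnn 0 0).trans (hsup 0 0)
    simp only [Nat.cast_zero, zero_add, Real.one_rpow, mul_one] at h
    exact h
  have hCρ0 : 0 ≤ Cρ := by
    have h0 := hin 0 ⟨le_rfl, ht.le⟩ 0
    exact (hc.trans (h0.1.trans h0.2.1)).le
  have hδpos : 0 < 1 / (4 * (27 * C + 1)) := by positivity
  -- `N₀`: room for the packing count and a small bad-event probability
  have hevA : ∀ᶠ N : ℕ in atTop, ((N : ℝ) + 1) ^ (-γ) < 1 / 4 :=
    (mcKRC_tendsto_scale hγ).eventually (gt_mem_nhds (by norm_num))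
  have hevB := hT.eventually (gt_mem_nhds (ENNReal.ofReal_pos.2 hδpos))
  obtain ⟨N₀, hN₀⟩ := eventually_atTop.1 (hevA.and hevB)
  refine ⟨3 / 4, by norm_num, N₀, fun N hN s hs x => ?_⟩
  obtain ⟨hA, hB⟩ := hN₀ N hN
  haveI := isProbabilityMeasure_localGibbsLaw ha hθ hu ha0 hθ0 hσ2 N (Φ N)
  -- the in-mean bound off the bad event
  have hmean : ∫ z, empiricalDensityField ((Φ N).flow s z) (fun y => φ N (y - x))
      ∂(localGibbsLaw σ a₀ u₀ θ₀ N (Φ N)) ≤ Cρ + 27 * C / σ ^ 3 * (1 / (4 * (27 * C + 1))) := by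
    refine meanCeiling_integral_le_of_ae_cap (localGibbsLaw σ a₀ u₀ θ₀ N (Φ N))
      (meanCeiling_measurable_blockDensity_flow (Φ N) s (hsm N).continuous x).aestronglyMeasurable
      hCρ0 (by positivity) hδpos.le (Eventually.of_forall fun z => ?_)
      (meanCeiling_blockDensity_le_cap_ae hσ hσ2 a₀ θ₀ u₀ (Φ N) s x (by linarith) (hnn N) (hsup N)
        (hsupp N) hA)
      (Eventually.of_forall fun z hz => ?_) hB.le
    · rw [AprioriBoundsNegative.empiricalDensityField_eq_sum]
      exact mul_nonneg (by positivity) (Finset.sum_nonneg fun i _ => hnn N _)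
    · by_contra hlt
      refine hz ⟨s, hs, x, fun hb => ?_⟩
      have hle : empiricalDensityField ((Φ N).flow s z) (fun y => φ N (-(x - y))) ≤ Cρ := hb.2.1
      simp only [neg_sub] at hle
      exact hlt hle
  -- arithmetic: `Cρ σ³ < 1/2`, `27 C / (4 (27 C + 1)) ≤ 1/4`
  have h27 : 27 * C / σ ^ 3 * (1 / (4 * (27 * C + 1))) * σ ^ 3 ≤ 1 / 4 := by
    rw [show 27 * C / σ ^ 3 * (1 / (4 * (27 * C + 1))) * σ ^ 3 = 27 * C / (4 * (27 * C + 1)) by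
      field_simp]
    rw [div_le_div_iff₀ (by positivity) (by norm_num)]
    nlinarith
  calc (∫ z, empiricalDensityField ((Φ N).flow s z) (fun y => φ N (y - x))
        ∂(localGibbsLaw σ a₀ u₀ θ₀ N (Φ N))) * σ ^ 3
      ≤ (Cρ + 27 * C / σ ^ 3 * (1 / (4 * (27 * C + 1)))) * σ ^ 3 :=
        mul_le_mul_of_nonneg_right hmean hσ3.le
    _ = Cρ * σ ^ 3 + 27 * C / σ ^ 3 * (1 / (4 * (27 * C + 1))) * σ ^ 3 := by ring
    _ ≤ 1 / 2 + 1 / 4 := add_le_add hCρ.le h27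
    _ = 3 / 4 := by norm_num

end Summit.AtomisticToContinuum.HydrodynamicLimit.Theorems.MesoChebyshevWindow

end
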